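import Mathlib
import Literature.NumberTheory.Sieve.LargestPrimeFactorCubic
import Literature.NumberTheory.Sieve.CompletionOfSums
import Literature.NumberTheory.LFunctions.KloostermanWeilReduction
import HarnessLib

/-!
# Heath-Brown's `q`-analogue of van der Corput: completion and the complete sums `S(q, m, a)`
# (PLMS 82 (2001), §9, the case `k = 0`)

Topic `Literature/NumberTheory/Sieve`, grouping namespace `ShortKloosterman` (continuation of
`ShortKloostermanDifferencing`).  The case `k = 0` of Heath-Brown's Theorem 2
(`Literature.NumberTheory.Sieve.HeathBrown2001_thm2_shortKloosterman`) is proved in the paper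
(D. R. Heath-Brown, *The largest prime factor of `X³ + 2`*, Proc. London Math. Soc. (3) 82 (2001)
554–596, §9 pp. 35–36 of the held text) "in the usual way": completion
`S = q⁻¹ Σ_{m (mod q)} S(q, m, 1) Σ_{A<n≤A+B} e_q(−mn)` (9.1) with the complete sums
`S(q, m, a) = Σ_{h (mod q), (g(h),q)=1} e_q(a{w f(h)\overline{g(h)} + m h})`, their twisted
multiplicativity `S(uv, m, a) = S(u, m, a\bar v) S(v, m, a\bar u)`, the evaluation at primes
`p ∣ w`, Weil's estimate at primes `p ∤ w`, and the harmonic bound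
`Σ_{∆ ∣ m} min(B, ‖m/q‖⁻¹) ≪ B + (q/∆) log q`.  This file PROVES everything in that paragraph
except Weil's estimate, which enters the product bound as a hypothesis on the prime factors:

* §1 `completeSum q f g c m = Σ_{x mod q, g(x) unit} e_q(c f(x)\overline{g(x)} + m x)`
  (`= S(q, m, a)` with `c = aw`, `m ↦ am`), the trivial bound, `q = 1`;
* §2 **twisted multiplicativity** `completeSum (q₁q₂) = completeSum q₁ (\bar q₂ ·) · completeSum q₂ (\bar q₁ ·)`
  (`completeSum_mul_of_coprime`), from the tree's CRT lemmas for Kloosterman sums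
  (`Literature.NumberTheory.LFunctions.stdAddChar_eq_mul_of_coprime`, `isUnit_iff_of_coprime`);
* §3 the prime `p ∣ w` (`c = 0`): `|Σ_{g(x) ≠ 0} e_p(mx)| ≤ deg g` for `m ≢ 0` (the paper's
  "`S(p,m,a) = 0` for `p ∤ m`" overlooks the `≤ D` excluded roots of `g`; harmless);
* §4 **the product bound** over a square-free modulus (`norm_completeSum_le_prod`): if at every
  prime `p ∣ q` one has `|completeSum p f g 0 m| ≤ K` (`m ≠ 0`) and
  `|completeSum p f g c m| ≤ K√p` (`c ≠ 0`; this is where Weil's estimate, or for small `p` the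
  trivial bound, is fed in), then `|completeSum q f g c m| ≤ Π_{p∣q} β_p` with
  `β_p = p, K, K√p` according as `p ∣ c, p ∣ m` / `p ∣ c, p ∤ m` / `p ∤ c`; and
  `Π_p β_p ≤ K^{ω(q)} (∆, m) (q/∆)^{1/2}`, `∆ = Π_{p ∣ q, p ∣ c} p` (`prod_localFactor_le`);
* §5 **completion with g.c.d. weights** (`norm_sum_Ioc_le_of_dft_le_gcd`): for `Φ : ℤ/q → ℂ`
  with `|𝓕Φ(b)| ≤ M (∆, b)` (`∆ ∣ q`), `‖Σ_{A<n≤A+N} Φ(n)‖ ≤ M (∆ N / q + τ(∆)(1 + log q))`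
  for every INTEGER `A` — the harmonic-sum step of p. 36;
* §6 the bridge `shortKloostermanSum q f g w A B = Σ_{A<n≤A+B} Φ(n)` with
  `𝓕Φ(b) = completeSum q f g w (−b)`.

No named facts are introduced.

## References

* D. R. Heath-Brown, *The largest prime factor of `X³ + 2`*, Proc. London Math. Soc. (3) 82
  (2001) 554–596, §9 pp. 35–36 (held text `paper:heathbrown2001-largest-prime-factor-i-x-i-sup`).
  [`HeathBrown2001LargestPrimeFactorCubic`]
* O. Bordellès, *Arithmetic Tales. Advanced Edition*, Universitext (2020), Thm 6.13 (completion).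
  [`Bordelles2020ArithmeticTales`]
-/

noncomputable section

open Finset Polynomial

namespace Literature.NumberTheory.Sieve

namespace ShortKloosterman

open Literature.NumberTheory.LFunctions (stdAddChar_eq_mul_of_coprime castHom_inv_of_isUnit
  isUnit_iff_of_coprime)

/-! ### §1. The complete sums `S(q, m, a)` -/

section Complete

/-- The reduction of an integral polynomial modulo `q`. [folklore] -/
abbrev redPoly (q : ℕ) (f : ℤ[X]) : (ZMod q)[X] := f.map (Int.castRingHom (ZMod q))

/-- Reduction in stages: reducing modulo `q` and then casting to `ZMod q'` (`q' ∣ q`) is reducing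
modulo `q'`. [folklore] -/
theorem map_castHom_redPoly {q q' : ℕ} (h : q' ∣ q) (f : ℤ[X]) :
    (redPoly q f).map (ZMod.castHom h (ZMod q')) = redPoly q' f := by
  rw [redPoly, Polynomial.map_map]
  congr 1
  exact RingHom.ext_int _ _

/-- `((f.eval n : ℤ) : ZMod q) = (f mod q)(n mod q)`. [folklore] -/
theorem intCast_eval (q : ℕ) (f : ℤ[X]) (n : ℤ) :
    ((f.eval n : ℤ) : ZMod q) = (redPoly q f).eval (n : ZMod q) := by
  rw [redPoly, eval_map, ← eq_intCast (Int.castRingHom (ZMod q)) n, eval₂_at_apply, eq_intCast]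

/-- Casting an evaluation down to `ZMod q'`. [folklore] -/
theorem castHom_eval_redPoly {q q' : ℕ} (h : q' ∣ q) (f : ℤ[X]) (x : ZMod q) :
    ZMod.castHom h (ZMod q') ((redPoly q f).eval x) =
      (redPoly q' f).eval (ZMod.castHom h (ZMod q') x) := by
  conv_rhs => rw [← map_castHom_redPoly h f, eval_map, eval₂_at_apply]

open scoped Classical in
/-- **Heath-Brown's complete sum** `S(q, m, a) = Σ_{h (mod q), (g(h),q)=1} e_q(a{w f(h)\overline{g(h)} + mh})`
(p. 35), written with `c = aw` and `m` for `am`: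
`completeSum q f g c m = Σ_{x ∈ ℤ/q, g(x) ∈ (ℤ/q)ˣ} e_q(c f(x) g(x)⁻¹ + m x)`.
[cite: HeathBrown2001LargestPrimeFactorCubic, §9 p. 35 (the sums `S(q, m, a)`)] -/
def completeSum (q : ℕ) [NeZero q] (f g : ℤ[X]) (c m : ZMod q) : ℂ :=
  ∑ x : ZMod q, if IsUnit ((redPoly q g).eval x) then
    (ZMod.stdAddChar (c * (redPoly q f).eval x * ((redPoly q g).eval x)⁻¹ + m * x) : ℂ) else 0

/-- The trivial bound `|S(q, m, a)| ≤ q`. [folklore] -/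
theorem norm_completeSum_le (q : ℕ) [NeZero q] (f g : ℤ[X]) (c m : ZMod q) :
    ‖completeSum q f g c m‖ ≤ q := by
  classical
  unfold completeSum
  refine (norm_sum_le _ _).trans ?_
  have : ∀ x ∈ (Finset.univ : Finset (ZMod q)),
      ‖(if IsUnit ((redPoly q g).eval x) then
        (ZMod.stdAddChar (c * (redPoly q f).eval x * ((redPoly q g).eval x)⁻¹ + m * x) : ℂ)
        else 0)‖ ≤ 1 := by
    intro x _
    split_ifs
    · exact (AddChar.norm_apply _ _).le
    · simp
  refine (Finset.sum_le_sum this).trans ?_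
  simp [ZMod.card]

end Complete

/-! ### §2. Twisted multiplicativity -/

section CRT

/-- **Twisted multiplicativity** (Heath-Brown p. 35: "`S(uv, m, a) = S(u, m, a\bar v) S(v, m, a\bar u)`
for `(u, v) = 1`"): for coprime `q₁, q₂`,
`completeSum (q₁q₂) f g c m = completeSum q₁ f g (\bar q₂ c) (\bar q₂ m) · completeSum q₂ f g (\bar q₁ c) (\bar q₁ m)`,
`\bar q₂ = (q₂ mod q₁)⁻¹`, `\bar q₁ = (q₁ mod q₂)⁻¹`, `c, m` reduced modulo `q₁`, `q₂` on the right.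
[cite: HeathBrown2001LargestPrimeFactorCubic, §9 p. 35] -/
theorem completeSum_mul_of_coprime {q₁ q₂ : ℕ} [NeZero q₁] [NeZero q₂] [NeZero (q₁ * q₂)]
    (h : q₁.Coprime q₂) (f g : ℤ[X]) (c m : ZMod (q₁ * q₂)) :
    completeSum (q₁ * q₂) f g c m =
      completeSum q₁ f g ((q₂ : ZMod q₁)⁻¹ * ZMod.castHom (dvd_mul_right q₁ q₂) (ZMod q₁) c)
          ((q₂ : ZMod q₁)⁻¹ * ZMod.castHom (dvd_mul_right q₁ q₂) (ZMod q₁) m) *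
        completeSum q₂ f g ((q₁ : ZMod q₂)⁻¹ * ZMod.castHom (dvd_mul_left q₂ q₁) (ZMod q₂) c)
          ((q₁ : ZMod q₂)⁻¹ * ZMod.castHom (dvd_mul_left q₂ q₁) (ZMod q₂) m) := by
  classical
  set π₁ := ZMod.castHom (dvd_mul_right q₁ q₂) (ZMod q₁) with hπ₁
  set π₂ := ZMod.castHom (dvd_mul_left q₂ q₁) (ZMod q₂) with hπ₂
  set e₂ : ZMod q₁ := (q₂ : ZMod q₁)⁻¹ with he₂
  set e₁ : ZMod q₂ := (q₁ : ZMod q₂)⁻¹ with he₁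
  set E := ZMod.chineseRemainder h with hE
  have hE1 : ∀ x, (E x).1 = π₁ x := fun x => Prod.fst_zmod_cast x
  have hE2 : ∀ x, (E x).2 = π₂ x := fun x => Prod.snd_zmod_cast x
  set F := redPoly (q₁ * q₂) f with hF
  set G := redPoly (q₁ * q₂) g with hG
  set F₁ := redPoly q₁ f with hF₁
  set G₁ := redPoly q₁ g with hG₁
  set F₂ := redPoly q₂ f with hF₂
  set G₂ := redPoly q₂ g with hG₂
  have hFe1 : ∀ x, π₁ (F.eval x) = F₁.eval (π₁ x) := fun x => castHom_eval_redPoly _ f x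
  have hGe1 : ∀ x, π₁ (G.eval x) = G₁.eval (π₁ x) := fun x => castHom_eval_redPoly _ g x
  have hFe2 : ∀ x, π₂ (F.eval x) = F₂.eval (π₂ x) := fun x => castHom_eval_redPoly _ f x
  have hGe2 : ∀ x, π₂ (G.eval x) = G₂.eval (π₂ x) := fun x => castHom_eval_redPoly _ g x
  -- the summand in product form
  set g₁ : ZMod q₁ → ℂ := fun x₁ => if IsUnit (G₁.eval x₁) then
    (ZMod.stdAddChar (e₂ * π₁ c * F₁.eval x₁ * (G₁.eval x₁)⁻¹ + e₂ * π₁ m * x₁) : ℂ) else 0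
    with hg₁
  set g₂ : ZMod q₂ → ℂ := fun x₂ => if IsUnit (G₂.eval x₂) then
    (ZMod.stdAddChar (e₁ * π₂ c * F₂.eval x₂ * (G₂.eval x₂)⁻¹ + e₁ * π₂ m * x₂) : ℂ) else 0
    with hg₂
  have hS : completeSum (q₁ * q₂) f g c m = ∑ x : ZMod (q₁ * q₂), g₁ (E x).1 * g₂ (E x).2 := by
    unfold completeSum
    refine Finset.sum_congr rfl fun x _ => ?_
    rw [hE1, hE2]
    by_cases hx : IsUnit (G.eval x)
    · obtain ⟨hx1, hx2⟩ := (isUnit_iff_of_coprime h (G.eval x)).mp hx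
      rw [← hG, ← hF, if_pos hx]
      simp only [hg₁, hg₂]
      rw [hGe1] at hx1
      rw [hGe2] at hx2
      rw [if_pos hx1, if_pos hx2, stdAddChar_eq_mul_of_coprime h]
      congr 2
      · rw [map_add, map_mul, map_mul, map_mul, castHom_inv_of_isUnit _ hx, hFe1, hGe1]; ring
      · rw [map_add, map_mul, map_mul, map_mul, castHom_inv_of_isUnit _ hx, hFe2, hGe2]; ring
    · have hx' : ¬ (IsUnit (π₁ (G.eval x)) ∧ IsUnit (π₂ (G.eval x))) := fun h' =>
        hx ((isUnit_iff_of_coprime h (G.eval x)).mpr h')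
      rw [← hG, if_neg hx]
      simp only [hg₁, hg₂]
      rw [hGe1, hGe2] at hx'
      by_cases h1 : IsUnit (G₁.eval (π₁ x))
      · rw [if_neg (fun h2 => hx' ⟨h1, h2⟩), mul_zero]
      · rw [if_neg h1, zero_mul]
  rw [hS, Fintype.sum_equiv E.toEquiv (fun x => g₁ (E x).1 * g₂ (E x).2)
    (fun y : ZMod q₁ × ZMod q₂ => g₁ y.1 * g₂ y.2) (fun x => rfl), Fintype.sum_prod_type,
    ← Fintype.sum_mul_sum]
  rfl

end CRT

/-! ### §3. The local factors at a prime -/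

section Local

variable {p : ℕ} [Fact p.Prime]

/-- At a prime `p ∣ w` (`c = 0`) with `m ≢ 0`:
`|Σ_{g(x) ≠ 0} e_p(mx)| = |−Σ_{g(x) = 0} e_p(mx)| ≤ #{roots of g mod p} ≤ deg g`, provided
`g ≢ 0 (mod p)` (Heath-Brown p. 35 states `S(p, m, a) = 0` for `p ∤ m`, overlooking the roots
of `g`; the bound `deg g` is what the argument uses).
[cite: HeathBrown2001LargestPrimeFactorCubic, §9 p. 35] -/
theorem norm_completeSum_zero_le (f g : ℤ[X]) (hg : redPoly p g ≠ 0) {m : ZMod p} (hm : m ≠ 0) :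
    ‖completeSum p f g 0 m‖ ≤ g.natDegree := by
  classical
  have hfield : ∀ x : ZMod p, IsUnit ((redPoly p g).eval x) ↔ (redPoly p g).eval x ≠ 0 :=
    fun x => isUnit_iff_ne_zero
  -- `completeSum p f g 0 m = Σ_x ψ(mx) − Σ_{g(x)=0} ψ(mx)` and `Σ_x ψ(mx) = 0`
  have hsplit : completeSum p f g 0 m =
      ∑ x : ZMod p, (ZMod.stdAddChar (m * x) : ℂ) -
        ∑ x ∈ Finset.univ.filter (fun x : ZMod p => (redPoly p g).eval x = 0),
          (ZMod.stdAddChar (m * x) : ℂ) := by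
    unfold completeSum
    rw [Finset.sum_filter, ← Finset.sum_sub_distrib]
    refine Finset.sum_congr rfl fun x _ => ?_
    by_cases hx : (redPoly p g).eval x = 0
    · rw [if_neg (by rw [hfield]; exact fun h => h hx), if_pos hx, sub_self]
    · rw [if_pos ((hfield x).mpr hx), if_neg hx, sub_zero, zero_mul, zero_mul, zero_add]
  have hzero : ∑ x : ZMod p, (ZMod.stdAddChar (m * x) : ℂ) = 0 := by
    have h1 : ∑ x : ZMod p, (ZMod.stdAddChar (x * m) : ℂ) =
        ((if m = 0 then Fintype.card (ZMod p) else 0 : ℕ) : ℂ) :=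
      AddChar.sum_mulShift m (ZMod.isPrimitive_stdAddChar p)
    rw [if_neg hm, Nat.cast_zero] at h1
    rw [← h1]
    exact Finset.sum_congr rfl fun x _ => by rw [mul_comm]
  rw [hsplit, hzero, zero_sub, norm_neg]
  refine (norm_sum_le _ _).trans ?_
  have h1 : ∀ x ∈ Finset.univ.filter (fun x : ZMod p => (redPoly p g).eval x = 0),
      ‖(ZMod.stdAddChar (m * x) : ℂ)‖ ≤ 1 := fun x _ => (AddChar.norm_apply _ _).le
  refine (Finset.sum_le_sum h1).trans ?_
  rw [Finset.sum_const, nsmul_eq_mul, mul_one]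
  -- the zero set of `g mod p` has at most `deg g` elements
  have hsub : Finset.univ.filter (fun x : ZMod p => (redPoly p g).eval x = 0) ⊆
      (redPoly p g).roots.toFinset := by
    intro x hx
    rw [Finset.mem_filter] at hx
    rw [Multiset.mem_toFinset, mem_roots hg]
    exact hx.2
  calc ((Finset.univ.filter (fun x : ZMod p => (redPoly p g).eval x = 0)).card : ℝ)
      ≤ ((redPoly p g).roots.toFinset.card : ℝ) := by exact_mod_cast Finset.card_le_card hsub
    _ ≤ (redPoly p g).roots.card := by exact_mod_cast Multiset.toFinset_card_le _
    _ ≤ (redPoly p g).natDegree := by exact_mod_cast card_roots' _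
    _ ≤ g.natDegree := by exact_mod_cast natDegree_map_le

/-- In `ZMod p`, `p ∣ c.val ↔ c = 0`. [folklore] -/
theorem dvd_val_iff_eq_zero (c : ZMod p) : p ∣ c.val ↔ c = 0 := by
  rw [← ZMod.natCast_eq_zero_iff, ZMod.natCast_zmod_val]

end Local

/-! ### §4. The product bound over a square-free modulus -/

section Product

/-- The local factor `β_p`: `p` if `p ∣ c` and `p ∣ m`; `K` if `p ∣ c`, `p ∤ m`; `K √p` if
`p ∤ c`. [cite: HeathBrown2001LargestPrimeFactorCubic, §9 pp. 35–36] -/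
def localFactor (K : ℝ) (p : ℕ) (dc dm : Bool) : ℝ :=
  if dc then (if dm then p else K) else K * Real.sqrt p

/-- `β_p ≥ 0` for `K ≥ 0`. [folklore] -/
theorem localFactor_nonneg {K : ℝ} (hK : 0 ≤ K) (p : ℕ) (dc dm : Bool) :
    0 ≤ localFactor K p dc dm := by
  unfold localFactor
  split_ifs <;> positivity

/-- For `p ∣ n`, divisibility of the representative is detected in `ZMod p`:
`p ∣ z.val ↔ (z mod p) = 0`. [folklore] -/
theorem dvd_val_iff_castHom_eq_zero {n p : ℕ} [NeZero n] (h : p ∣ n) (z : ZMod n) :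
    p ∣ z.val ↔ ZMod.castHom h (ZMod p) z = 0 := by
  rw [ZMod.castHom_apply, ZMod.cast_eq_val, ZMod.natCast_eq_zero_iff]

/-- Multiplying by a unit does not change divisibility of the representative by `p ∣ n`.
[folklore] -/
theorem dvd_val_unit_mul_iff {n p : ℕ} [NeZero n] (h : p ∣ n) {e : ZMod n} (he : IsUnit e)
    (z : ZMod n) : p ∣ (e * z).val ↔ p ∣ z.val := by
  rw [dvd_val_iff_castHom_eq_zero h, dvd_val_iff_castHom_eq_zero h, map_mul]
  exact (he.map _).mul_right_eq_zero

/-- Casting to `ZMod q'` (`q' ∣ q`) does not change divisibility of the representative by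
`p ∣ q'`. [folklore] -/
theorem dvd_val_castHom_iff {q q' p : ℕ} [NeZero q] [NeZero q'] (h : q' ∣ q) (hp : p ∣ q')
    (z : ZMod q) : p ∣ (ZMod.castHom h (ZMod q') z).val ↔ p ∣ z.val := by
  rw [ZMod.castHom_apply, ZMod.cast_eq_val, ZMod.val_natCast]
  exact Nat.dvd_mod_iff hp

/-- The inverse of `q₂` modulo a coprime `q₁` is a unit. [folklore] -/
theorem isUnit_inv_natCast_of_coprime {q₁ q₂ : ℕ} [NeZero q₁] (h : q₁.Coprime q₂) :
    IsUnit ((q₂ : ZMod q₁)⁻¹) := by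
  have hu : IsUnit (q₂ : ZMod q₁) := (ZMod.isUnit_iff_coprime q₂ q₁).mpr h.symm
  exact isUnit_iff_exists_inv.mpr ⟨(q₂ : ZMod q₁), ZMod.inv_mul_of_unit _ hu⟩

/-- The prime case of the product bound. [cite: HeathBrown2001LargestPrimeFactorCubic, §9 p. 35] -/
theorem norm_completeSum_prime_le {K : ℝ} (f g : ℤ[X]) {p : ℕ} [Fact p.Prime]
    (h0 : ∀ m : ZMod p, m ≠ 0 → ‖completeSum p f g 0 m‖ ≤ K)
    (h1 : ∀ c : ZMod p, c ≠ 0 → ∀ m : ZMod p, ‖completeSum p f g c m‖ ≤ K * Real.sqrt p)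
    (c m : ZMod p) :
    ‖completeSum p f g c m‖ ≤ localFactor K p (p ∣ c.val) (p ∣ m.val) := by
  unfold localFactor
  by_cases hc : c = 0
  · have hdc : (decide (p ∣ c.val)) = true := by
      rw [decide_eq_true_eq, dvd_val_iff_eq_zero]; exact hc
    rw [hdc, if_pos rfl]
    by_cases hm : m = 0
    · have hdm : (decide (p ∣ m.val)) = true := by
        rw [decide_eq_true_eq, dvd_val_iff_eq_zero]; exact hm
      rw [hdm, if_pos rfl]
      exact norm_completeSum_le p f g c m
    · have hdm : (decide (p ∣ m.val)) = false := by
        rw [decide_eq_false_iff_not, dvd_val_iff_eq_zero]; exact hm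
      rw [hdm]
      simp only [Bool.false_eq_true, ↓reduceIte]
      rw [hc]; exact h0 m hm
  · have hdc : (decide (p ∣ c.val)) = false := by
      rw [decide_eq_false_iff_not, dvd_val_iff_eq_zero]; exact hc
    rw [hdc]
    simp only [Bool.false_eq_true, ↓reduceIte]
    exact h1 c hc m

/-- **The product bound** (Heath-Brown p. 35–36: "`|S(q, m, 1)| ≤ d_{2D}(q)(∆q)^{1/2}` when
`∆ ∣ m`", in the sharper prime-by-prime form): for square-free `q` and `K ≥ 1`, if at every
prime `p ∣ q` one has `|completeSum p f g 0 m| ≤ K` for `m ≠ 0` and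
`|completeSum p f g c m| ≤ K √p` for `c ≠ 0`, then
`|completeSum q f g c m| ≤ Π_{p ∣ q} β_p(p ∣ c, p ∣ m)`.
[cite: HeathBrown2001LargestPrimeFactorCubic, §9 pp. 35–36] -/
theorem norm_completeSum_le_prod {K : ℝ} (hK : 1 ≤ K) (f g : ℤ[X]) :
    ∀ (q : ℕ) [NeZero q], Squarefree q →
      (∀ (p : ℕ) [Fact p.Prime], p ∣ q →
        (∀ m : ZMod p, m ≠ 0 → ‖completeSum p f g 0 m‖ ≤ K) ∧
        (∀ c : ZMod p, c ≠ 0 → ∀ m : ZMod p, ‖completeSum p f g c m‖ ≤ K * Real.sqrt p)) →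
      ∀ c m : ZMod q, ‖completeSum q f g c m‖ ≤
        ∏ p ∈ q.primeFactors, localFactor K p (p ∣ c.val) (p ∣ m.val) := by
  intro q
  induction q using Nat.recOnPrimeCoprime with
  | zero => intro _ hsq; exact absurd hsq not_squarefree_zero
  | prime_pow p n hp =>
    intro _ hsq hloc c m
    rcases Nat.eq_zero_or_pos n with rfl | hn
    · -- `q = 1`: one term, everything a unit, `e_1 = 1`
      simp only [pow_zero, Nat.primeFactors_one, Finset.prod_empty]
      have : Subsingleton (ZMod (p ^ 0)) := by rw [pow_zero]; exact ZMod.subsingleton_iff.mpr rfl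
      unfold completeSum
      rw [Fintype.sum_subsingleton _ 0]
      split_ifs
      · exact (AddChar.norm_apply _ _).le
      · simp
    · -- `q = p` prime
      have hn1 : n = 1 := ((Nat.squarefree_pow_iff hp.ne_one hn.ne').mp hsq).2
      subst hn1
      have hq : (p ^ 1).Prime := by rw [pow_one]; exact hp
      haveI : Fact (p ^ 1).Prime := ⟨hq⟩
      rw [Nat.Prime.primeFactors hq, Finset.prod_singleton]
      obtain ⟨h0, h1⟩ := hloc (p ^ 1) (dvd_refl _)
      exact norm_completeSum_prime_le f g h0 h1 c m
  | coprime a b ha hb hab iha ihb =>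
    intro _ hsq hloc c m
    haveI : NeZero a := ⟨by omega⟩
    haveI : NeZero b := ⟨by omega⟩
    have hsqa : Squarefree a := Squarefree.of_mul_left hsq
    have hsqb : Squarefree b := Squarefree.of_mul_right hsq
    have hloca : ∀ (p : ℕ) [Fact p.Prime], p ∣ a →
        (∀ m : ZMod p, m ≠ 0 → ‖completeSum p f g 0 m‖ ≤ K) ∧
        (∀ c : ZMod p, c ≠ 0 → ∀ m : ZMod p, ‖completeSum p f g c m‖ ≤ K * Real.sqrt p) :=
      fun p _ hp => hloc p (hp.trans (dvd_mul_right a b))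
    have hlocb : ∀ (p : ℕ) [Fact p.Prime], p ∣ b →
        (∀ m : ZMod p, m ≠ 0 → ‖completeSum p f g 0 m‖ ≤ K) ∧
        (∀ c : ZMod p, c ≠ 0 → ∀ m : ZMod p, ‖completeSum p f g c m‖ ≤ K * Real.sqrt p) :=
      fun p _ hp => hloc p (hp.trans (dvd_mul_left b a))
    rw [completeSum_mul_of_coprime hab, norm_mul, Nat.Coprime.primeFactors_mul hab,
      Finset.prod_union hab.disjoint_primeFactors]
    set πa := ZMod.castHom (dvd_mul_right a b) (ZMod a)
    set πb := ZMod.castHom (dvd_mul_left b a) (ZMod b)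
    set ea : ZMod a := (b : ZMod a)⁻¹
    set eb : ZMod b := (a : ZMod b)⁻¹
    have hea : IsUnit ea := isUnit_inv_natCast_of_coprime hab
    have heb : IsUnit eb := isUnit_inv_natCast_of_coprime hab.symm
    have hA := iha hsqa hloca (ea * πa c) (ea * πa m)
    have hB := ihb hsqb hlocb (eb * πb c) (eb * πb m)
    -- the local factors agree prime by prime
    have hA' : ∏ p ∈ a.primeFactors, localFactor K p (p ∣ (ea * πa c).val) (p ∣ (ea * πa m).val) =
        ∏ p ∈ a.primeFactors, localFactor K p (p ∣ c.val) (p ∣ m.val) := by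
      refine Finset.prod_congr rfl fun p hp => ?_
      have hpa : p ∣ a := Nat.dvd_of_mem_primeFactors hp
      have e1 : decide (p ∣ (ea * πa c).val) = decide (p ∣ c.val) :=
        decide_eq_decide.mpr (by rw [dvd_val_unit_mul_iff hpa hea, dvd_val_castHom_iff _ hpa])
      have e2 : decide (p ∣ (ea * πa m).val) = decide (p ∣ m.val) :=
        decide_eq_decide.mpr (by rw [dvd_val_unit_mul_iff hpa hea, dvd_val_castHom_iff _ hpa])
      rw [e1, e2]
    have hB' : ∏ p ∈ b.primeFactors, localFactor K p (p ∣ (eb * πb c).val) (p ∣ (eb * πb m).val) =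
        ∏ p ∈ b.primeFactors, localFactor K p (p ∣ c.val) (p ∣ m.val) := by
      refine Finset.prod_congr rfl fun p hp => ?_
      have hpb : p ∣ b := Nat.dvd_of_mem_primeFactors hp
      have e1 : decide (p ∣ (eb * πb c).val) = decide (p ∣ c.val) :=
        decide_eq_decide.mpr (by rw [dvd_val_unit_mul_iff hpb heb, dvd_val_castHom_iff _ hpb])
      have e2 : decide (p ∣ (eb * πb m).val) = decide (p ∣ m.val) :=
        decide_eq_decide.mpr (by rw [dvd_val_unit_mul_iff hpb heb, dvd_val_castHom_iff _ hpb])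
      rw [e1, e2]
    rw [hA'] at hA
    rw [hB'] at hB
    have hK0 : 0 ≤ K := zero_le_one.trans hK
    exact mul_le_mul hA hB (norm_nonneg _)
      (Finset.prod_nonneg fun p _ => localFactor_nonneg hK0 _ _ _)

/-- **From local factors to `K^{ω(q)} (∆, m) (q/∆)^{1/2}`**: for square-free `q`, `K ≥ 1` and
any `c, m`, writing `∆ = Π_{p ∣ q, p ∣ c} p` (so that `∆ = (q, w)` when `c = w mod q`),
`Π_{p ∣ q} β_p ≤ K^{ω(q)} · (Π_{p∣q, p∣c, p∣m} p) · (Π_{p ∣ q, p ∤ c} √p)`.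
[cite: HeathBrown2001LargestPrimeFactorCubic, §9 p. 36] -/
theorem prod_localFactor_le {K : ℝ} (hK : 1 ≤ K) (q : ℕ) (dc dm : ℕ → Bool) :
    ∏ p ∈ q.primeFactors, localFactor K p (dc p) (dm p) ≤
      K ^ q.primeFactors.card *
        ((∏ p ∈ q.primeFactors.filter (fun p => dc p && dm p), (p : ℝ)) *
          ∏ p ∈ q.primeFactors.filter (fun p => !dc p), Real.sqrt p) := by
  rw [Finset.prod_filter, Finset.prod_filter, ← Finset.prod_mul_distrib, Finset.pow_card_mul_prod]
  refine Finset.prod_le_prod (fun p _ => localFactor_nonneg (zero_le_one.trans hK) _ _ _)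
    fun p hp => ?_
  have hp1 : (1 : ℝ) ≤ p := by exact_mod_cast (Nat.prime_of_mem_primeFactors hp).one_lt.le
  have hsp : (1 : ℝ) ≤ Real.sqrt p := by rw [← Real.sqrt_one]; exact Real.sqrt_le_sqrt hp1
  unfold localFactor
  cases dc p <;> cases dm p <;> simp
  nlinarith

end Product


/-! ### §5. Completion of sums with g.c.d.-weighted Fourier bounds -/

section Completion

open Literature.NumberTheory.Sieve.LargeSieve (e e_zero e_int e_add norm_sum_Ioc_e_le
  inv_norm_e_sub_one_le sum_Ioo_div_add_div_le sum_Ioc_eq_inv_mul_sum_dft_mul sum_Ioc_natCast)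

/-- Reindexing the multiples of `d` in `(0, q)`, `q = d q'`: they are `d b'`, `0 < b' < q'`.
[folklore] -/
theorem sum_Ioo_filter_dvd_eq {d q' : ℕ} (hd : 0 < d) (F : ℕ → ℝ) :
    ∑ b ∈ (Ioo 0 (d * q')).filter (fun b => d ∣ b), F b = ∑ b' ∈ Ioo 0 q', F (d * b') := by
  rw [← Finset.sum_image (f := F) (s := Ioo 0 q') (g := fun b' => d * b')
    (fun x _ y _ hxy => Nat.eq_of_mul_eq_mul_left hd hxy)]
  refine Finset.sum_congr ?_ fun _ _ => rfl
  ext b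
  simp only [Finset.mem_filter, Finset.mem_Ioo, Finset.mem_image]
  constructor
  · rintro ⟨⟨hb0, hbq⟩, ⟨b', rfl⟩⟩
    exact ⟨b', ⟨Nat.pos_of_mul_pos_left hb0, Nat.lt_of_mul_lt_mul_left hbq⟩, rfl⟩
  · rintro ⟨b', ⟨hb0, hbq⟩, rfl⟩
    exact ⟨⟨Nat.mul_pos hd hb0, Nat.mul_lt_mul_of_pos_left hbq hd⟩, dvd_mul_right d b'⟩

/-- **The harmonic step of p. 36**: for `∆ ∣ q`,
`Σ_{0<b<q} (∆, b) (q/(4b) + q/(4(q − b))) ≤ τ(∆) (q/2)(1 + log q)` — the paper's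
`Σ_{m (mod q), ∆∣m} ‖m/q‖⁻¹ ≪ (q/∆) log q` in the form needed with the weights `(∆, m)`.
[cite: HeathBrown2001LargestPrimeFactorCubic, §9 p. 36] -/
theorem sum_gcd_mul_div_add_div_le {q Δ : ℕ} (hΔ : Δ ∣ q) (hq : 0 < q) :
    ∑ b ∈ Ioo 0 q, (Nat.gcd Δ b : ℝ) * ((q : ℝ) / (4 * b) + (q : ℝ) / (4 * (q - b : ℕ))) ≤
      (Δ.divisors.card : ℝ) * ((q : ℝ) / 2 * (1 + Real.log q)) := by
  have hΔ0 : Δ ≠ 0 := by rintro rfl; rw [zero_dvd_iff] at hΔ; omega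
  set h : ℕ → ℝ := fun b => (q : ℝ) / (4 * b) + (q : ℝ) / (4 * (q - b : ℕ)) with hh
  have hpos : ∀ b : ℕ, 0 ≤ h b := fun b => by simp only [hh]; positivity
  -- `(∆, b) ≤ Σ_{d ∣ ∆, d ∣ b} d`
  have hgcd : ∀ b ∈ Ioo 0 q, (Nat.gcd Δ b : ℝ) * h b ≤
      ∑ d ∈ Δ.divisors.filter (fun d => d ∣ b), (d : ℝ) * h b := by
    intro b _
    have hmem : Nat.gcd Δ b ∈ Δ.divisors.filter (fun d => d ∣ b) := by
      rw [Finset.mem_filter, Nat.mem_divisors]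
      exact ⟨⟨Nat.gcd_dvd_left _ _, hΔ0⟩, Nat.gcd_dvd_right _ _⟩
    exact Finset.single_le_sum (s := Δ.divisors.filter (fun d => d ∣ b))
      (f := fun d : ℕ => (d : ℝ) * h b) (fun d _ => mul_nonneg (Nat.cast_nonneg _) (hpos b)) hmem
  refine (Finset.sum_le_sum hgcd).trans ?_
  -- exchange the sums
  rw [Finset.sum_comm' (t' := Δ.divisors) (s' := fun d => (Ioo 0 q).filter (fun b => d ∣ b))
    (fun d b => by
      simp only [Finset.mem_filter]
      tauto)]
  -- each `d ∣ ∆` contributes at most `(q/2)(1 + log q)`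
  have hterm : ∀ d ∈ Δ.divisors, ∑ b ∈ (Ioo 0 q).filter (fun b => d ∣ b), (d : ℝ) * h b ≤
      (q : ℝ) / 2 * (1 + Real.log q) := by
    intro d hd
    rw [Nat.mem_divisors] at hd
    obtain ⟨q', hq'⟩ : d ∣ q := hd.1.trans hΔ
    have hd0 : 0 < d := Nat.pos_of_ne_zero (ne_zero_of_dvd_ne_zero hΔ0 hd.1)
    have hq'0 : 0 < q' := by
      rcases Nat.eq_zero_or_pos q' with h0 | h0
      · subst h0; omega
      · exact h0
    have hdq : (d : ℝ) * q' = q := by rw [hq']; push_cast; ring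
    have hd0' : (0 : ℝ) < d := by exact_mod_cast hd0
    rw [hq', sum_Ioo_filter_dvd_eq hd0, ← hq']
    -- the summand at `b = d b'` is `d · (q'/(4b') + q'/(4(q' − b')))`
    have hsummand : ∀ b' ∈ Ioo 0 q', (d : ℝ) * h (d * b') =
        (d : ℝ) * ((q' : ℝ) / (4 * b') + (q' : ℝ) / (4 * (q' - b' : ℕ))) := by
      intro b' hb'
      rw [Finset.mem_Ioo] at hb'
      simp only [hh]
      have e1 : (q : ℝ) / (4 * (d * b' : ℕ)) = (q' : ℝ) / (4 * b') := by
        rw [← hdq]; push_cast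
        have : (b' : ℝ) ≠ 0 := by exact_mod_cast hb'.1.ne'
        field_simp
      have e2 : (q : ℝ) / (4 * (q - d * b' : ℕ)) = (q' : ℝ) / (4 * (q' - b' : ℕ)) := by
        have hsub : q - d * b' = d * (q' - b') := by rw [hq', Nat.mul_sub]
        rw [hsub, ← hdq]; push_cast
        have : ((q' - b' : ℕ) : ℝ) ≠ 0 := by
          have : 0 < q' - b' := Nat.sub_pos_of_lt hb'.2
          exact_mod_cast this.ne'
        field_simp
      rw [e1, e2]
    rw [Finset.sum_congr rfl hsummand, ← Finset.mul_sum]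
    have hharm := sum_Ioo_div_add_div_le q'
    have hq'le : (q' : ℝ) ≤ q := by
      rw [← hdq]
      have : (1 : ℝ) ≤ d := by exact_mod_cast hd0
      have : (0 : ℝ) ≤ q' := Nat.cast_nonneg _
      nlinarith
    have hlog : Real.log q' ≤ Real.log q :=
      Real.log_le_log (by exact_mod_cast hq'0) hq'le
    have hlog0 : 0 ≤ 1 + Real.log (q' : ℝ) := by
      have := Real.log_nonneg (show (1 : ℝ) ≤ q' by exact_mod_cast hq'0)
      linarith
    calc (d : ℝ) * ∑ b' ∈ Ioo 0 q', ((q' : ℝ) / (4 * b') + (q' : ℝ) / (4 * (q' - b' : ℕ)))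
        ≤ (d : ℝ) * ((q' : ℝ) / 2 * (1 + Real.log q')) := mul_le_mul_of_nonneg_left hharm hd0'.le
      _ = (q : ℝ) / 2 * (1 + Real.log q') := by rw [← hdq]; ring
      _ ≤ (q : ℝ) / 2 * (1 + Real.log q) := by
          apply mul_le_mul_of_nonneg_left _ (by positivity)
          linarith
  refine (Finset.sum_le_sum hterm).trans ?_
  rw [Finset.sum_const, nsmul_eq_mul]

/-- Periodicity: the incomplete sum over `(A, A + N]` for an INTEGER `A` equals the one over
`(A', A' + N]` with `0 ≤ A' < q` the residue of `A`. [folklore] -/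
theorem sum_Ioc_int_eq_sum_Ioc_nat {q : ℕ} [NeZero q] (Φ : ZMod q → ℂ) (A : ℤ) (N : ℕ) :
    ∑ n ∈ Ioc A (A + N), Φ (n : ZMod q) =
      ∑ n ∈ Ioc (A % q).toNat ((A % q).toNat + N), Φ ((n : ℕ) : ZMod q) := by
  have hq : (0 : ℤ) < q := by exact_mod_cast Nat.pos_of_ne_zero (NeZero.ne q)
  set A' : ℕ := (A % q).toNat with hA'
  have hA'eq : (A' : ℤ) = A % q := Int.toNat_of_nonneg (Int.emod_nonneg A hq.ne')
  set t : ℤ := A / q with ht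
  have hAt : A = A' + q * t := by rw [hA'eq, ht, Int.emod_add_mul_ediv]
  rw [show ∑ n ∈ Ioc A' (A' + N), Φ ((n : ℕ) : ZMod q) =
      ∑ n ∈ Ioc A' (A' + N), Φ (((n : ℕ) : ℤ) : ZMod q) from
    Finset.sum_congr rfl fun n _ => by rw [Int.cast_natCast],
    ← sum_Ioc_natCast (fun n : ℤ => Φ (n : ZMod q)) A' N]
  -- shift the integer interval by `q t`
  have hshift : ∑ n ∈ Ioc (A' : ℤ) (A' + N), Φ ((n + q * t : ℤ) : ZMod q) =
      ∑ n ∈ Ioc A (A + N), Φ (n : ZMod q) := by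
    have hI : Ioc A (A + N) = (Ioc (A' : ℤ) (A' + N)).map (addRightEmbedding ((q : ℤ) * t)) := by
      rw [Finset.map_add_right_Ioc, hAt]
      congr 1
      ring
    rw [hI, Finset.sum_map]
    rfl
  rw [← hshift]
  refine Finset.sum_congr rfl fun n _ => ?_
  congr 1
  push_cast
  rw [ZMod.natCast_self, zero_mul, add_zero]

/-- **Completion with g.c.d.-weighted Fourier bounds** (the completion step (9.1) + the harmonic
bound of Heath-Brown p. 36, here over an arbitrary integer interval): for `q ≥ 1`, `∆ ∣ q`,
`Φ : ℤ/qℤ → ℂ` and `M ≥ 0` with `|𝓕Φ(b)| ≤ M (∆, b)` for all `0 ≤ b < q`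
(`𝓕Φ(b) = Σ_j e(−jb/q) Φ(j)`, Mathlib's `ZMod.dft`; at `b = 0` the bound is `M ∆`),
`‖Σ_{A<n≤A+N} Φ(n)‖ ≤ M (∆ N / q + τ(∆)(1 + log q))` for every `A ∈ ℤ`, `N ∈ ℕ`.
[cite: HeathBrown2001LargestPrimeFactorCubic, §9 pp. 35–36, (9.1)]
[cite: Bordelles2020ArithmeticTales, Thm 6.13] -/
theorem norm_sum_Ioc_le_of_dft_le_gcd {q : ℕ} [NeZero q] (Φ : ZMod q → ℂ) {Δ : ℕ} (hΔ : Δ ∣ q)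
    {M : ℝ} (hM0 : 0 ≤ M) (hM : ∀ b : ℕ, b < q → ‖ZMod.dft Φ (b : ZMod q)‖ ≤ M * Nat.gcd Δ b)
    (A : ℤ) (N : ℕ) :
    ‖∑ n ∈ Ioc A (A + N), Φ (n : ZMod q)‖ ≤
      M * ((Δ : ℝ) * N / q + (Δ.divisors.card : ℝ) * (1 + Real.log q)) := by
  have hq0' : 0 < q := Nat.pos_of_ne_zero (NeZero.ne q)
  have hq0 : (0 : ℝ) < q := by exact_mod_cast hq0'
  rw [sum_Ioc_int_eq_sum_Ioc_nat Φ A N]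
  set A' : ℕ := (A % q).toNat
  -- completion: `Σ = q⁻¹ Σ_{b<q} 𝓕Φ(b) Σ_n e(bn/q)`
  rw [sum_Ioc_eq_inv_mul_sum_dft_mul Φ A' N]
  have hr : range q = insert 0 (Ioo 0 q) := by
    ext b; simp only [mem_range, mem_insert, mem_Ioo]; omega
  -- the term `b = 0`
  have h0 : ‖ZMod.dft Φ ((0 : ℕ) : ZMod q) *
      ∑ n ∈ Ioc A' (A' + N), e (((0 : ℕ) : ℝ) * (n : ℕ) / q)‖ ≤ M * Δ * N := by
    have : ∀ n : ℕ, e (((0 : ℕ) : ℝ) * (n : ℕ) / q) = 1 := fun n => by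
      rw [Nat.cast_zero, zero_mul, zero_div, e_zero]
    simp only [this, sum_const, Nat.card_Ioc, nsmul_eq_mul, mul_one, add_tsub_cancel_left]
    rw [norm_mul, Complex.norm_natCast]
    have h1 := hM 0 hq0'
    rw [Nat.gcd_zero_right] at h1
    exact mul_le_mul_of_nonneg_right h1 (Nat.cast_nonneg _)
  -- the terms `0 < b < q`
  have hterm : ∀ b ∈ Ioo 0 q,
      ‖ZMod.dft Φ (b : ZMod q) * ∑ n ∈ Ioc A' (A' + N), e ((b : ℝ) * (n : ℕ) / q)‖ ≤
        M * (2 * ((Nat.gcd Δ b : ℝ) * ((q : ℝ) / (4 * b) + (q : ℝ) / (4 * (q - b : ℕ))))) := by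
    intro b hb
    rw [mem_Ioo] at hb
    obtain ⟨hb0, hbq⟩ := hb
    have hne : e ((b : ℝ) / q) ≠ 1 := by
      intro h
      have h1 : ‖e ((b : ℝ) / q) - 1‖ = 0 := by rw [h, sub_self, norm_zero]
      rw [LargeSieve.norm_e_sub_one] at h1
      have hpos : 0 < Real.sin (Real.pi * ((b : ℝ) / q)) := by
        refine Real.sin_pos_of_pos_of_lt_pi (by positivity) ?_
        calc Real.pi * ((b : ℝ) / q) < Real.pi * 1 := by
              gcongr; rw [div_lt_one hq0]; exact_mod_cast hbq
          _ = Real.pi := mul_one _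
      have : |Real.sin (Real.pi * ((b : ℝ) / q))| = 0 := by linarith
      rw [abs_eq_zero] at this
      linarith
    have hgeom : ‖∑ n ∈ Ioc A' (A' + N), e ((b : ℝ) * (n : ℕ) / q)‖ ≤ 2 / ‖e ((b : ℝ) / q) - 1‖ := by
      have := norm_sum_Ioc_e_le A' N hne
      refine le_of_eq_of_le (congr_arg _ (sum_congr rfl fun n _ => ?_)) this
      congr 1; ring
    rw [norm_mul]
    have hgb : (0 : ℝ) ≤ Nat.gcd Δ b := Nat.cast_nonneg _
    calc ‖ZMod.dft Φ (b : ZMod q)‖ * ‖∑ n ∈ Ioc A' (A' + N), e ((b : ℝ) * (n : ℕ) / q)‖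
        ≤ (M * Nat.gcd Δ b) * (2 / ‖e ((b : ℝ) / q) - 1‖) :=
          mul_le_mul (hM b hbq) hgeom (norm_nonneg _) (mul_nonneg hM0 hgb)
      _ = M * (2 * ((Nat.gcd Δ b : ℝ) * ‖e ((b : ℝ) / q) - 1‖⁻¹)) := by rw [div_eq_mul_inv]; ring
      _ ≤ M * (2 * ((Nat.gcd Δ b : ℝ) * ((q : ℝ) / (4 * b) + (q : ℝ) / (4 * (q - b : ℕ))))) :=
          mul_le_mul_of_nonneg_left (mul_le_mul_of_nonneg_left
            (mul_le_mul_of_nonneg_left (inv_norm_e_sub_one_le hb0 hbq) hgb) zero_le_two) hM0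
  have hsum : ‖∑ b ∈ Ioo 0 q, ZMod.dft Φ (b : ZMod q) *
      ∑ n ∈ Ioc A' (A' + N), e ((b : ℝ) * (n : ℕ) / q)‖ ≤
        M * (2 * ((Δ.divisors.card : ℝ) * ((q : ℝ) / 2 * (1 + Real.log q)))) := by
    refine (norm_sum_le _ _).trans ((sum_le_sum hterm).trans ?_)
    rw [← mul_sum, ← mul_sum]
    exact mul_le_mul_of_nonneg_left (mul_le_mul_of_nonneg_left
      (sum_gcd_mul_div_add_div_le hΔ hq0') zero_le_two) hM0
  rw [hr, sum_insert (by simp), norm_mul, norm_inv, Complex.norm_natCast]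
  calc (q : ℝ)⁻¹ * ‖ZMod.dft Φ ((0 : ℕ) : ZMod q) *
          ∑ n ∈ Ioc A' (A' + N), e (((0 : ℕ) : ℝ) * (n : ℕ) / q) +
        ∑ b ∈ Ioo 0 q, ZMod.dft Φ (b : ZMod q) * ∑ n ∈ Ioc A' (A' + N), e ((b : ℝ) * (n : ℕ) / q)‖
      ≤ (q : ℝ)⁻¹ * (M * Δ * N + M * (2 * ((Δ.divisors.card : ℝ) * ((q : ℝ) / 2 * (1 + Real.log q))))) := by
        refine mul_le_mul_of_nonneg_left ((norm_add_le _ _).trans (add_le_add h0 hsum)) ?_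
        positivity
    _ = M * ((Δ : ℝ) * N / q + (Δ.divisors.card : ℝ) * (1 + Real.log q)) := by
        field_simp

end Completion

/-! ### §6. The bridge to `shortKloostermanSum` -/

section Bridge

open scoped Classical in
/-- The periodic function behind the short Kloosterman sum:
`Φ(x) = e_q(w f(x) g(x)⁻¹)` if `g(x)` is a unit modulo `q`, else `0`.
[cite: HeathBrown2001LargestPrimeFactorCubic, Thm. 2 (the summand of `S`, p. 3)] -/
def periodicPhase (q : ℕ) [NeZero q] (f g : ℤ[X]) (w : ℤ) (x : ZMod q) : ℂ :=
  if IsUnit ((redPoly q g).eval x) then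
    (ZMod.stdAddChar ((w : ZMod q) * (redPoly q f).eval x * ((redPoly q g).eval x)⁻¹) : ℂ)
  else 0

/-- `shortKloostermanSum q f g w A B = Σ_{A < n ≤ A + B} Φ(n mod q)`. [folklore] -/
theorem shortKloostermanSum_eq_sum_periodicPhase (q : ℕ) [NeZero q] (f g : ℤ[X]) (w A : ℤ)
    (B : ℕ) :
    shortKloostermanSum q f g w A B = ∑ n ∈ Ioc A (A + B), periodicPhase q f g w (n : ZMod q) := by
  unfold shortKloostermanSum periodicPhase
  refine Finset.sum_congr rfl fun n _ => ?_
  rw [intCast_eval q g n, intCast_eval q f n]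
  split_ifs with h
  · rw [ZMod.stdAddChar_apply, ZMod.toCircle_apply]
    congr 1
    push_cast
    ring
  · rfl

/-- **The finite Fourier transform of `Φ` is a complete sum**:
`𝓕Φ(b) = Σ_x e_q(−xb) Φ(x) = completeSum q f g w (−b)`. [cite: HeathBrown2001LargestPrimeFactorCubic, §9 p. 35, (9.1)] -/
theorem dft_periodicPhase (q : ℕ) [NeZero q] (f g : ℤ[X]) (w : ℤ) (b : ZMod q) :
    ZMod.dft (periodicPhase q f g w) b = completeSum q f g (w : ZMod q) (-b) := by
  classical
  rw [ZMod.dft_apply]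
  unfold completeSum periodicPhase
  refine Finset.sum_congr rfl fun x _ => ?_
  split_ifs with h
  · rw [smul_eq_mul, ← AddChar.map_add_eq_mul]
    congr 1; ring
  · rw [smul_zero]

end Bridge

end ShortKloosterman

end Literature.NumberTheory.Sieve
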